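import Literature.Computability.Learning.IWPadGenerator
import Literature.Computability.Complexity.UniversalNEXPLanguage
import HarnessLib

/-!
# The IW generator on the pad IS the Nisan–Wigderson generator on the explicit design

Consumer of `IWPadGenerator.lean` (S6.1 of the discharge of `impagliazzoWigderson1998(_samplable)`):
the string computed by `IWGen.iwGen k e c₀ ℓ σ` is identified with the output of
`MetaComplexity.nwGenerator` on the explicit design `cikkDesign q ℓ ℓ'` (`q = prmQ ℓ`), the hard
function `f_ℓ = H.sliceFn ℓ = [· ∈ H]` on `ℓ`-bit inputs and the seed `z = σ ↾ q²`, as soon as the pad `2^{ℓ^{c₀}}`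
covers the budget of `H`'s decider:

* `vOf`, `zOf` — the block index function and the seed read off the strings; `uOf_eq_ofFn` — the
  computed restricted seed is `z|_{S_{v_j}}` (`restrictFn_eq_ofFn_cikkDesign`);
* **`iwGen_eq_ofFn_nwGenerator`** — for `H ∈ DTIME T` there are a code word `e`, a constant `c` and a
  polynomial `p` with `iwGen k e c₀ ℓ σ = ofFn (NW^{f_ℓ}(z))` whenever `q² ≤ |σ|` and
  `p(c·T(ℓ) + c) ≤ 2^{ℓ^{c₀}}`.

## References

* R. Impagliazzo, A. Wigderson, JCSS 63 (2001), §2 [ImpagliazzoWigderson2001].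
* L. Trevisan, S. Vadhan, Comput. Complexity 16 (2007), Thm. 3.9 [TrevisanVadhan2007].
* N. Nisan, A. Wigderson, JCSS 49 (1994), §2 [NisanWigderson1994].
* S. Arora, B. Barak, CUP 2009, Def. 20.12, Thm. 1.9/§1.4.1 [AroraBarakCC2009].
-/

noncomputable section

open Polynomial Filter

namespace Literature.Computability.Learning

open Literature.Computability.Complexity Literature.Computability.Complexity.Brick
  Literature.Computability.Complexity.Plumb Literature.Computability.MetaComplexity _root_.Computability

namespace IWGen

variable (k : ℕ)

/-- `q = prmQ ℓ` is prime (instance for `cikkDesign`). [folklore] -/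
instance fact_prime_prmQ (ℓ : ℕ) : Fact (prmQ ℓ).Prime := ⟨(prmQ_spec ℓ).2⟩

/-- The `j`-th block index as a function `Fin ℓ' → Bool`. [folklore] -/
def vOf (ℓ j : ℕ) : Fin (lp k ℓ) → Bool := fun t => (vbitsOf (lp k ℓ) j)[(t : ℕ)]'(by simp)

/-- `ofFn (vOf …) = vbitsOf …`. [folklore] -/
theorem ofFn_vOf (ℓ j : ℕ) : List.ofFn (vOf k ℓ j) = vbitsOf (lp k ℓ) j := by
  apply List.ext_getElem (by simp)
  intro i h₁ h₂
  simp [vOf]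

/-- The seed `z = σ ↾ q²` as a function on the design universe `Fin (q·q)` (`q² ≤ |σ|`). [folklore] -/
def zOf (ℓ : ℕ) (σ : List Bool) (hσ : prmQ ℓ * prmQ ℓ ≤ σ.length) : Fin (prmQ ℓ * prmQ ℓ) → Bool :=
  fun p => (σ.take (prmQ ℓ * prmQ ℓ))[(p : ℕ)]'(by rw [List.length_take, min_eq_left hσ]; exact p.isLt)

/-- `ofFn (zOf …) = σ ↾ q²`. [folklore] -/
theorem ofFn_zOf (ℓ : ℕ) (σ : List Bool) (hσ : prmQ ℓ * prmQ ℓ ≤ σ.length) :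
    List.ofFn (zOf ℓ σ hσ) = σ.take (prmQ ℓ * prmQ ℓ) := by
  apply List.ext_getElem (by rw [List.length_ofFn, List.length_take, min_eq_left hσ])
  intro i h₁ h₂
  simp [zOf]

/-- The explicit design used by the generator at length `ℓ`: block `j ↦ S_{v_j}`. [folklore] -/
def designOf (ℓ : ℕ) (j : Fin (ℓ ^ k)) : Fin ℓ ↪ Fin (prmQ ℓ * prmQ ℓ) :=
  cikkDesign (prmQ ℓ) ℓ (lp k ℓ) (prmQ_spec ℓ).1 (vOf k ℓ j)

/-- **The computed restricted seed is `z|_{S_{v_j}}`.** [cite: AroraBarakCC2009, Def. 20.12] -/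
theorem uOf_eq_ofFn (ℓ : ℕ) (σ : List Bool) (hσ : prmQ ℓ * prmQ ℓ ≤ σ.length) (j : ℕ) :
    uOf k ℓ σ j = List.ofFn (zOf ℓ σ hσ ∘ cikkDesign (prmQ ℓ) ℓ (lp k ℓ) (prmQ_spec ℓ).1 (vOf k ℓ j)) := by
  rw [uOf, ← ofFn_vOf, ← ofFn_zOf ℓ σ hσ]
  exact restrictFn_eq_ofFn_cikkDesign [] (prmQ ℓ) ℓ (lp k ℓ) (prmQ_spec ℓ).1 (vOf k ℓ j) (zOf ℓ σ hσ)

/-! The hard function at length `ℓ` is the slice `H.sliceFn ℓ = fun u => [ofFn u ∈ H]`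
(`Language.sliceFn`, `BoolEncodings.lean`). -/

/-- **The IW generator on the pad is the NW generator on the explicit design** (value theorem):
for `H ∈ DTIME T` there are a code word `e`, a constant `c` and an overhead polynomial `p` such that,
whenever the seed is long enough (`q² ≤ |σ|`) and the pad covers the budget (`p(c·T(ℓ)+c) ≤ 2^{ℓ^{c₀}}`),
`iwGen k e c₀ ℓ σ` lists `NW^{f_ℓ}(z) = (f_ℓ(z|_{S_{v_j}}))_{j < ℓ^k}`.
[cite: TrevisanVadhan2007, Thm. 3.9] [cite: NisanWigderson1994, §2] [cite: AroraBarakCC2009, Def. 20.12] -/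
theorem iwGen_eq_ofFn_nwGenerator {H : Language Bool} {T : ℕ → ℕ} (hH : H ∈ DTIME T) :
    ∃ (e : List Bool) (c : ℕ) (p : Polynomial ℕ), ∀ (c₀ ℓ : ℕ) (σ : List Bool)
      (hσ : prmQ ℓ * prmQ ℓ ≤ σ.length), p.eval (c * T ℓ + c) ≤ 2 ^ ℓ ^ c₀ →
        iwGen k e c₀ ℓ σ =
          List.ofFn (nwGenerator (designOf k ℓ) (H.sliceFn ℓ) (zOf ℓ σ hσ)) := by
  obtain ⟨c, M, hM⟩ := hH
  refine ⟨ClockedUS.ecode M, c, ClockedUA.pM M, fun c₀ ℓ σ hσ hbud => ?_⟩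
  have hlen : ∀ j, (uOf k ℓ σ j).length = ℓ := fun j => by rw [uOf_eq_ofFn k ℓ σ hσ j, List.length_ofFn]
  have hrun : ∀ j, j < ℓ ^ k →
      ClockedUS.run (boolPair (ClockedUS.ecode M) (uOf k ℓ σ j)) (2 ^ ℓ ^ c₀) = some [H.boolIndicator (uOf k ℓ σ j)] := by
    intro j _
    have h1 : ClockedUS.run (boolPair (ClockedUS.ecode M) (uOf k ℓ σ j))
        ((ClockedUA.pM M).eval (c * T (uOf k ℓ σ j).length + c)) = some [H.boolIndicator (uOf k ℓ σ j)] :=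
      ClockedUS.sim M (hM (uOf k ℓ σ j))
    rw [hlen j] at h1
    exact ClockedUS.run_mono hbud h1
  rw [iwGen, iwGenF_apply k _ (2 ^ ℓ ^ c₀) ℓ σ (fun j => H.boolIndicator (uOf k ℓ σ j)) hrun, ccat_singleton_eq_ofFn]
  congr 1
  funext j
  rw [nwGenerator_apply, Language.sliceFn, designOf, uOf_eq_ofFn k ℓ σ hσ]

/-! ### The pad covers the budget for all large `ℓ` -/

/-- For `H ∈ DTIME(2^{n^b})` the overhead `p(c·2^{ℓ^b} + c)` of the clocked simulation is eventually
below the pad `2^{ℓ^{c₀}}`, `c₀ > b`. [folklore] -/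
theorem eventually_budget_le (p : Polynomial ℕ) (c b c₀ : ℕ) (hc₀ : b < c₀) :
    ∀ᶠ ℓ in atTop, p.eval (c * 2 ^ ℓ ^ b + c) ≤ 2 ^ ℓ ^ c₀ := by
  filter_upwards [eventually_eval_mul_two_pow_pow_le p (2 * c) b, eventually_ge_atTop 1] with ℓ hℓ hℓ1
  have h1 : c * 2 ^ ℓ ^ b + c ≤ 2 * c * 2 ^ ℓ ^ b := by
    have : c ≤ c * 2 ^ ℓ ^ b := Nat.le_mul_of_pos_right c (Nat.one_le_two_pow)
    nlinarith
  have h2 : 2 ^ ℓ ^ (b + 1) ≤ 2 ^ ℓ ^ c₀ :=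
    Nat.pow_le_pow_right (by norm_num) (Nat.pow_le_pow_right hℓ1 hc₀)
  exact ((natPoly_eval_mono p h1).trans hℓ).trans h2

/-- **For all large `ℓ` the IW generator on the pad is the NW generator** (`H ∈ DTIME(2^{n^b})`,
`c₀ > b`, seeds of length `≥ q²`). [cite: TrevisanVadhan2007, Thm. 3.9] -/
theorem eventually_iwGen_eq_ofFn_nwGenerator {H : Language Bool} {b c₀ : ℕ}
    (hH : H ∈ DTIME (fun n => 2 ^ n ^ b)) (hc₀ : b < c₀) :
    ∃ e : List Bool, ∀ᶠ ℓ in atTop, ∀ (σ : List Bool) (hσ : prmQ ℓ * prmQ ℓ ≤ σ.length),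
      iwGen k e c₀ ℓ σ = List.ofFn (nwGenerator (designOf k ℓ) (H.sliceFn ℓ) (zOf ℓ σ hσ)) := by
  obtain ⟨e, c, p, h⟩ := iwGen_eq_ofFn_nwGenerator k hH
  refine ⟨e, ?_⟩
  filter_upwards [eventually_budget_le p c b c₀ hc₀] with ℓ hℓ σ hσ
  exact h c₀ ℓ σ hσ hℓ

end IWGen

end Literature.Computability.Learning

end
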